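import Mathlib
import Summits.Ventures.PercRepro2.Defs
import Summits.Ventures.PercRepro2.Graph
import Summits.Ventures.PercRepro2.Harris
import Summits.Ventures.PercRepro2.Events
import Summits.Ventures.PercRepro2.Independence
import Summits.Ventures.PercRepro2.Induced
import Summits.Ventures.PercRepro2.Exploration
import Summits.Ventures.PercRepro2.SideCluster
import Summits.Ventures.PercRepro2.CactusDefs

/-!
# The cluster law along a pendant triangle (blind cell PercRepro2, mine-c g10;
proofs/MINEC-FEEDBACK.md §13)

For a pendant triangle `{x, y, z}` (edges `e₁ = xy`, `e₂ = xz`, `e₃ = yz`; `y, z` new, `≠ s`) the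
cluster of `G[F ∪ △]` is the cluster of `G[F]` together with `y` iff `x ∈ C` and (`e₁` open or
`e₂, e₃` open), and `z` symmetrically (`clusterOn_insert_triangle`). Hence the cluster law
factorises, `massOn (F ∪ △) W = massOn F ((W.erase y).erase z) · gTri W` (`massOn_insert_triangle`),
with `gTri` the TRACE LAW of the triangle seen from `x`:
`f(∅) = (1−q₁)(1−q₂)`, `f({y}) = q₁(1−q₂)(1−q₃)`, `f({z}) = (1−q₁)q₂(1−q₃)`,
`f({y,z}) = q₁q₂ + q₁(1−q₂)q₃ + (1−q₁)q₂q₃`, which is log-supermodular: the only incomparable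
pair gives `f({y}) f({z}) ≤ f(∅) f({y,z})` (`gTri_lsm`).
-/

namespace Summit.Ventures.PercRepro2

namespace Cactus

open scoped Classical

attribute [local instance 2000] Classical.propDecidable

variable {V : Type*} {E : Type*} [Fintype E] [Fintype V]
variable {R : Type*} [Field R] [LinearOrder R] [IsStrictOrderedRing R]

section Triangle

variable {ends : E → Sym2 V} {F : Set E} {e₁ e₂ e₃ : E} {x y z s : V}

omit [Fintype E] [Fintype V] in
/-- **The cluster of `G[F ∪ △]`** for a pendant triangle. -/
lemma clusterOn_insert_triangle (h₁ : ends e₁ = s(x, y)) (h₂ : ends e₂ = s(x, z))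
    (h₃ : ends e₃ = s(y, z)) (hxy : x ≠ y) (hxz : x ≠ z) (hyz : y ≠ z) (hys : y ≠ s) (hzs : z ≠ s)
    (hy : ∀ e' ∈ F, y ∉ ends e') (hz : ∀ e' ∈ F, z ∉ ends e') (ω : Config E) (v : V) :
    v ∈ clusterOn ends (insert e₁ (insert e₂ (insert e₃ F))) ω s ↔
      v ∈ clusterOn ends F ω s ∨
        (v = y ∧ x ∈ clusterOn ends F ω s ∧ (ω e₁ = true ∨ (ω e₂ = true ∧ ω e₃ = true))) ∨
        (v = z ∧ x ∈ clusterOn ends F ω s ∧ (ω e₂ = true ∨ (ω e₁ = true ∧ ω e₃ = true))) := by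
  simp only [clusterOn, mem_cluster]
  have hyF : ∀ v, Conn ends (restrict F ω) s v → v ≠ y := fun v hv hvy =>
    hys (eq_of_conn_restrict_of_isolated hy (hvy ▸ hv)).symm
  have hzF : ∀ v, Conn ends (restrict F ω) s v → v ≠ z := fun v hv hvz =>
    hzs (eq_of_conn_restrict_of_isolated hz (hvz ▸ hv)).symm
  have hsub : F ⊆ insert e₁ (insert e₂ (insert e₃ F)) := fun e' he' =>
    Set.mem_insert_of_mem _ (Set.mem_insert_of_mem _ (Set.mem_insert_of_mem _ he'))
  constructor
  · intro h
    let S : Set V := {v | Conn ends (restrict F ω) s v ∨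
      (v = y ∧ Conn ends (restrict F ω) s x ∧ (ω e₁ = true ∨ (ω e₂ = true ∧ ω e₃ = true))) ∨
      (v = z ∧ Conn ends (restrict F ω) s x ∧ (ω e₂ = true ∨ (ω e₁ = true ∧ ω e₃ = true)))}
    have hS : ∀ v ∈ S, ∀ v', (openGraph ends (restrict (insert e₁ (insert e₂ (insert e₃ F))) ω)).Adj
        v v' → v' ∈ S := by
      intro v hv v' hadj
      obtain ⟨_, hadj⟩ := openGraph_adj.1 hadj
      obtain ⟨e', he', he'F, hends⟩ := openAdj_restrict_iff.1 hadj
      rcases hv with hv | ⟨rfl, hx, hc⟩ | ⟨rfl, hx, hc⟩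
      · -- from a vertex of the old cluster
        rcases Set.mem_insert_iff.1 he'F with rfl | he'F
        · rw [h₁, Sym2.eq_iff] at hends
          rcases hends with ⟨rfl, rfl⟩ | ⟨rfl, rfl⟩
          · exact Or.inr (Or.inl ⟨rfl, hv, Or.inl he'⟩)
          · exact (hyF _ hv rfl).elim
        rcases Set.mem_insert_iff.1 he'F with rfl | he'F
        · rw [h₂, Sym2.eq_iff] at hends
          rcases hends with ⟨rfl, rfl⟩ | ⟨rfl, rfl⟩
          · exact Or.inr (Or.inr ⟨rfl, hv, Or.inl he'⟩)
          · exact (hzF _ hv rfl).elim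
        rcases Set.mem_insert_iff.1 he'F with rfl | he'F
        · rw [h₃, Sym2.eq_iff] at hends
          rcases hends with ⟨h1, _⟩ | ⟨_, h2⟩
          · exact (hyF _ hv h1.symm).elim
          · exact (hzF _ hv h2.symm).elim
        · exact Or.inl (conn_trans hv (conn_of_openAdj (openAdj_restrict_iff.2 ⟨e', he', he'F, hends⟩)))
      · -- from `y`
        rcases Set.mem_insert_iff.1 he'F with rfl | he'F
        · rw [h₁, Sym2.eq_iff] at hends
          rcases hends with ⟨h1, _⟩ | ⟨h1, _⟩
          · exact (hxy h1).elim
          · rw [← h1]; exact Or.inl hx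
        rcases Set.mem_insert_iff.1 he'F with rfl | he'F
        · rw [h₂, Sym2.eq_iff] at hends
          rcases hends with ⟨h1, _⟩ | ⟨_, h2⟩
          · exact (hxy h1).elim
          · exact (hyz h2.symm).elim
        rcases Set.mem_insert_iff.1 he'F with rfl | he'F
        · rw [h₃, Sym2.eq_iff] at hends
          rcases hends with ⟨_, h2⟩ | ⟨_, h2⟩
          · rw [← h2]
            refine Or.inr (Or.inr ⟨rfl, hx, ?_⟩)
            rcases hc with hc | ⟨hc, _⟩
            · exact Or.inr ⟨hc, he'⟩
            · exact Or.inl hc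
          · exact (hyz h2.symm).elim
        · exact (hy e' he'F (by rw [hends]; exact Sym2.mem_mk_left _ _)).elim
      · -- from `z`
        rcases Set.mem_insert_iff.1 he'F with rfl | he'F
        · rw [h₁, Sym2.eq_iff] at hends
          rcases hends with ⟨h1, _⟩ | ⟨_, h2⟩
          · exact (hxz h1).elim
          · exact (hyz h2).elim
        rcases Set.mem_insert_iff.1 he'F with rfl | he'F
        · rw [h₂, Sym2.eq_iff] at hends
          rcases hends with ⟨h1, _⟩ | ⟨h1, _⟩
          · exact (hxz h1).elim
          · rw [← h1]; exact Or.inl hx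
        rcases Set.mem_insert_iff.1 he'F with rfl | he'F
        · rw [h₃, Sym2.eq_iff] at hends
          rcases hends with ⟨h1, _⟩ | ⟨h1, _⟩
          · exact (hyz h1).elim
          · rw [← h1]
            refine Or.inr (Or.inl ⟨rfl, hx, ?_⟩)
            rcases hc with hc | ⟨hc, _⟩
            · exact Or.inr ⟨hc, he'⟩
            · exact Or.inl hc
        · exact (hz e' he'F (by rw [hends]; exact Sym2.mem_mk_left _ _)).elim
    exact mem_of_conn_of_closed hS (Or.inl (conn_refl _ _ _)) h
  · have hle := openGraph_mono (ends := ends) (restrict_mono_set hsub ω)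
    have step : ∀ {a b : V} (e : E), e ∈ insert e₁ (insert e₂ (insert e₃ F)) → ω e = true →
        ends e = s(a, b) → Conn ends (restrict (insert e₁ (insert e₂ (insert e₃ F))) ω) a b :=
      fun e heF he hends => conn_of_openAdj (openAdj_restrict_iff.2 ⟨e, he, heF, hends⟩)
    have m1 : e₁ ∈ insert e₁ (insert e₂ (insert e₃ F)) := Set.mem_insert _ _
    have m2 : e₂ ∈ insert e₁ (insert e₂ (insert e₃ F)) :=
      Set.mem_insert_of_mem _ (Set.mem_insert _ _)
    have m3 : e₃ ∈ insert e₁ (insert e₂ (insert e₃ F)) :=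
      Set.mem_insert_of_mem _ (Set.mem_insert_of_mem _ (Set.mem_insert _ _))
    rintro (h | ⟨rfl, hx, hc⟩ | ⟨rfl, hx, hc⟩)
    · exact h.mono hle
    · refine conn_trans (hx.mono hle) ?_
      rcases hc with hc | ⟨hc₂, hc₃⟩
      · exact step e₁ m1 hc h₁
      · exact conn_trans (step e₂ m2 hc₂ h₂) (conn_symm (step e₃ m3 hc₃ h₃))
    · refine conn_trans (hx.mono hle) ?_
      rcases hc with hc | ⟨hc₁, hc₃⟩
      · exact step e₂ m2 hc h₂
      · exact conn_trans (step e₁ m1 hc₁ h₁) (step e₃ m3 hc₃ h₃)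

/-! ## The trace law of the triangle -/

omit [Fintype E] [Fintype V] [LinearOrder R] [IsStrictOrderedRing R] in
/-- The trace law of a pendant triangle seen from `x ∈ W`, on the bits `y ∈ W`, `z ∈ W`. -/
noncomputable def fTri (q₁ q₂ q₃ : R) (b c : Bool) : R :=
  if b then (if c then q₁ * q₂ + q₁ * (1 - q₂) * q₃ + (1 - q₁) * q₂ * q₃
             else q₁ * (1 - q₂) * (1 - q₃))
  else (if c then (1 - q₁) * q₂ * (1 - q₃) else (1 - q₁) * (1 - q₂))

omit [Fintype E] [Fintype V] [LinearOrder R] [IsStrictOrderedRing R] in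
/-- The trace law of a pendant triangle on the bits `x ∈ W`, `y ∈ W`, `z ∈ W`. -/
noncomputable def gTriBool (q₁ q₂ q₃ : R) (a b c : Bool) : R :=
  if a then fTri q₁ q₂ q₃ b c else (if b || c then 0 else 1)

omit [Fintype E] [Fintype V] [LinearOrder R] [IsStrictOrderedRing R] in
/-- The trace law of a pendant triangle. -/
noncomputable def gTri (p : E → R) (e₁ e₂ e₃ : E) (x y z : V) (W : Finset V) : R :=
  gTriBool (p e₁) (p e₂) (p e₃) (decide (x ∈ W)) (decide (y ∈ W)) (decide (z ∈ W))

omit [Fintype E] [Fintype V] in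
/-- The key inequality: `f({y}) f({z}) ≤ f(∅) f({y, z})`. -/
lemma tri_key {q₁ q₂ q₃ : R} (h₁ : 0 ≤ q₁) (h₁' : q₁ ≤ 1) (h₂ : 0 ≤ q₂) (h₂' : q₂ ≤ 1)
    (h₃ : 0 ≤ q₃) (h₃' : q₃ ≤ 1) :
    q₁ * (1 - q₂) * (1 - q₃) * ((1 - q₁) * q₂ * (1 - q₃)) ≤
      (1 - q₁) * (1 - q₂) * (q₁ * q₂ + q₁ * (1 - q₂) * q₃ + (1 - q₁) * q₂ * q₃) := by
  have hdiff : (1 - q₁) * (1 - q₂) * (q₁ * q₂ + q₁ * (1 - q₂) * q₃ + (1 - q₁) * q₂ * q₃) -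
      q₁ * (1 - q₂) * (1 - q₃) * ((1 - q₁) * q₂ * (1 - q₃)) =
      (1 - q₁) * (1 - q₂) * (q₁ * q₂ * q₃ * (2 - q₃) + q₃ * (q₁ * (1 - q₂) + (1 - q₁) * q₂)) := by
    ring
  have hnn : 0 ≤ (1 - q₁) * (1 - q₂) *
      (q₁ * q₂ * q₃ * (2 - q₃) + q₃ * (q₁ * (1 - q₂) + (1 - q₁) * q₂)) := by
    apply mul_nonneg (mul_nonneg (by linarith) (by linarith))
    apply add_nonneg
    · exact mul_nonneg (mul_nonneg (mul_nonneg h₁ h₂) h₃) (by linarith)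
    · exact mul_nonneg h₃ (add_nonneg (mul_nonneg h₁ (by linarith)) (mul_nonneg (by linarith) h₂))
  linarith

omit [Fintype E] [Fintype V] in
/-- The two-bit trace law is nonnegative. -/
lemma fTri_nonneg {q₁ q₂ q₃ : R} (h₁ : 0 ≤ q₁) (h₁' : q₁ ≤ 1) (h₂ : 0 ≤ q₂) (h₂' : q₂ ≤ 1)
    (h₃ : 0 ≤ q₃) (h₃' : q₃ ≤ 1) (b c : Bool) : 0 ≤ fTri q₁ q₂ q₃ b c := by
  cases b <;> cases c <;> simp only [fTri, Bool.false_eq_true, if_false, if_true]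
  · exact mul_nonneg (by linarith) (by linarith)
  · exact mul_nonneg (mul_nonneg (by linarith) h₂) (by linarith)
  · exact mul_nonneg (mul_nonneg h₁ (by linarith)) (by linarith)
  · exact add_nonneg (add_nonneg (mul_nonneg h₁ h₂) (mul_nonneg (mul_nonneg h₁ (by linarith)) h₃))
      (mul_nonneg (mul_nonneg (by linarith) h₂) h₃)

omit [Fintype E] [Fintype V] in
/-- **The two-bit trace law is log-supermodular**: the only incomparable pair is `tri_key`. -/
lemma fTri_lsm {q₁ q₂ q₃ : R} (h₁ : 0 ≤ q₁) (h₁' : q₁ ≤ 1) (h₂ : 0 ≤ q₂) (h₂' : q₂ ≤ 1)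
    (h₃ : 0 ≤ q₃) (h₃' : q₃ ≤ 1) (b₁ c₁ b₂ c₂ : Bool) :
    fTri q₁ q₂ q₃ b₁ c₁ * fTri q₁ q₂ q₃ b₂ c₂ ≤
      fTri q₁ q₂ q₃ (b₁ && b₂) (c₁ && c₂) * fTri q₁ q₂ q₃ (b₁ || b₂) (c₁ || c₂) := by
  have key := tri_key h₁ h₁' h₂ h₂' h₃ h₃'
  cases b₁ <;> cases c₁ <;> cases b₂ <;> cases c₂ <;> simp [fTri]
  all_goals first
    | exact key
    | (rw [mul_comm]; exact key)
    | (rw [mul_comm])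

omit [Fintype E] [Fintype V] in
/-- The three-bit trace law is nonnegative. -/
lemma gTriBool_nonneg {q₁ q₂ q₃ : R} (h₁ : 0 ≤ q₁) (h₁' : q₁ ≤ 1) (h₂ : 0 ≤ q₂) (h₂' : q₂ ≤ 1)
    (h₃ : 0 ≤ q₃) (h₃' : q₃ ≤ 1) (a b c : Bool) : 0 ≤ gTriBool q₁ q₂ q₃ a b c := by
  cases a
  · simp only [gTriBool, Bool.false_eq_true, if_false]
    split_ifs <;> norm_num
  · simpa only [gTriBool, if_true] using fTri_nonneg h₁ h₁' h₂ h₂' h₃ h₃' b c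

omit [Fintype E] [Fintype V] in
/-- **The trace law of a pendant triangle is log-supermodular in its three bits.** -/
lemma gTriBool_lsm {q₁ q₂ q₃ : R} (h₁ : 0 ≤ q₁) (h₁' : q₁ ≤ 1) (h₂ : 0 ≤ q₂) (h₂' : q₂ ≤ 1)
    (h₃ : 0 ≤ q₃) (h₃' : q₃ ≤ 1) (a₁ b₁ c₁ a₂ b₂ c₂ : Bool) :
    gTriBool q₁ q₂ q₃ a₁ b₁ c₁ * gTriBool q₁ q₂ q₃ a₂ b₂ c₂ ≤
      gTriBool q₁ q₂ q₃ (a₁ && a₂) (b₁ && b₂) (c₁ && c₂) *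
        gTriBool q₁ q₂ q₃ (a₁ || a₂) (b₁ || b₂) (c₁ || c₂) := by
  have hg := gTriBool_nonneg h₁ h₁' h₂ h₂' h₃ h₃'
  cases a₁ <;> cases a₂
  · -- neither contains `x`: indicators
    cases b₁ <;> cases c₁ <;> cases b₂ <;> cases c₂ <;> simp [gTriBool]
  · -- only the second contains `x`
    cases b₁ <;> cases c₁
    · simp [gTriBool]
    · rw [show gTriBool q₁ q₂ q₃ false false true = 0 by simp [gTriBool], zero_mul]
      exact mul_nonneg (hg _ _ _) (hg _ _ _)
    · rw [show gTriBool q₁ q₂ q₃ false true false = 0 by simp [gTriBool], zero_mul]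
      exact mul_nonneg (hg _ _ _) (hg _ _ _)
    · rw [show gTriBool q₁ q₂ q₃ false true true = 0 by simp [gTriBool], zero_mul]
      exact mul_nonneg (hg _ _ _) (hg _ _ _)
  · -- only the first contains `x`
    cases b₂ <;> cases c₂
    · simp [gTriBool]
    · rw [show gTriBool q₁ q₂ q₃ false false true = 0 by simp [gTriBool], mul_zero]
      exact mul_nonneg (hg _ _ _) (hg _ _ _)
    · rw [show gTriBool q₁ q₂ q₃ false true false = 0 by simp [gTriBool], mul_zero]
      exact mul_nonneg (hg _ _ _) (hg _ _ _)
    · rw [show gTriBool q₁ q₂ q₃ false true true = 0 by simp [gTriBool], mul_zero]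
      exact mul_nonneg (hg _ _ _) (hg _ _ _)
  · -- both contain `x`
    simp only [gTriBool, Bool.true_and, Bool.true_or, if_true]
    exact fTri_lsm h₁ h₁' h₂ h₂' h₃ h₃' b₁ c₁ b₂ c₂

omit [Fintype E] [Fintype V] in
/-- **The trace law of a pendant triangle is log-supermodular.** -/
theorem gTri_lsm {p : E → R} (hp : IsProbVec p) (e₁ e₂ e₃ : E) (x y z : V) (W₁ W₂ : Finset V) :
    gTri p e₁ e₂ e₃ x y z W₁ * gTri p e₁ e₂ e₃ x y z W₂ ≤
      gTri p e₁ e₂ e₃ x y z (W₁ ∩ W₂) * gTri p e₁ e₂ e₃ x y z (W₁ ∪ W₂) := by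
  unfold gTri
  simp only [Finset.mem_inter, Finset.mem_union, Bool.decide_and, Bool.decide_or]
  exact gTriBool_lsm (hp.nonneg e₁) (hp.le_one e₁) (hp.nonneg e₂) (hp.le_one e₂) (hp.nonneg e₃)
    (hp.le_one e₃) _ _ _ _ _ _


end Triangle

end Cactus

end Summit.Ventures.PercRepro2
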